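import Literature.AnabelianGeometry.EtaleTheta.ThetaRootOrbitsMonodromyToy
import HarnessLib

/-!
# [EtTh] §2 Def. 2.7 at the MONODROMY TOY, part B1 (PROOF-ONLY): coordinates on `Π^tp_Ÿ` and `Δ_Θ`, and the
# INTRINSIC CHARACTERISATION of the print-recipe collection `η̈^{Θ,ℤ×μ₂}` of part A

S. Mochizuki, *The étale theta function and its Frobenioid-theoretic manifestations* [EtTh], Publ. RIMS **45**
(2009), §1 Prop. 1.3 p. 14 (the étale theta class), §2 Def. 2.5 p. 39, Def. 2.7 p. 41 (the orbit collections
`η̈^{Θ,ℤ×μ₂} ⊇ η̈^{Θ,l·ℤ×μ₂} ⊇ η̈^{Θ,l·ℤ}`) (PRIMS text pages) [cite: MochizukiEtTh2009, Def 2.7 p.41].  Cell `abc-iut`,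
F lane, FACT-LIST row F-0640 `ThetaOrbitData.Cor28_i`, seat abc-iut-f-128 (gen 14); abc-iut-L2-lead R1504 (WELCOME,
COUNT-NEUTRAL).  PROOF-ONLY sequel of part A (`ThetaRootOrbitsMonodromyToy.lean`: the orbit datum
`thetaOrbitData l hl` over abc-iut-w6-d084's `monodromyModel l hl`; HONEST LABEL R1352 DESIGNED TOY, verbatim there);
consumed by part B2 (`ThetaRootOrbitsMonodromyToyCor28i.lean`: clauses C1–C3 of the typed Cor. 2.8 (i) for every `Γ`,
and `¬ Cor28_i` via `γ_t`).

RESULTS (every `l`; `Π^tp_C = TG l = ((ℤ/l × ℤ/l) ⋊ D_∞) × ℤ/2`, `Π^tp_Ÿ = {d = 1, e = 1} ≅ (ℤ/l)²`, cusp inertia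
`z = ((0,1),1,1)`, loop `t = ((0,0), r 1, 1)`, `x₀ = ((1,0),1,1)`):
* §1 `b`, `c` are additive on `Π^tp_Ÿ`; `top = ⟨z⟩` is CENTRAL in `Π^tp_C` (`conj_eq_of_mem_thetaTop`); `c ↦ [z^c]`
  (`thetaCoeff`) is a multiplicative bijection `ℤ/l ≅ Δ_Θ = top/1`, so `Δ_Θ` is commutative.
* §2 the toy theta class and its translates `η_{ε,k} : (b, c) ↦ [z^{ε c + k b}]` are multiplicative (`etaFn_mul`),
  TAUTOLOGICAL on the cusp inertia — `η_{ε,k}([τ]) = [τ]^{±1}` for `τ ∈ Δ_Θ` (`etaFn_apply_thetaTop`) —, conjugation by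
  the loop is the shear `(b, c) ↦ (b, c + b)` (`conj_tT_coords`), so `η₀ ∘ γ_{t^k} = η_{1,k}` (`etaFn_one_zero_conj_tT_pow`)
  and `η_{−1,−k} = η_{1,k}⁻¹` (`etaFn_neg`): the collection `η̈^{Θ,ℤ×μ₂}` of part A IS the `(Gal(Y/X) × μ₂)`-orbit of `η₀`;
  and **`mem_etaColl_iff`**: a class lies in `η̈^{Θ,ℤ×μ₂}` iff it is the singleton of a MULTIPLICATIVE
  `η : Π^tp_Ÿ → Δ_Θ` whose restriction to `Δ_Θ = ⟨z⟩` is `[·]^{σ}`, `σ = ±1` (via `Π^tp_Ÿ = ⟨x₀⟩·⟨z⟩`).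
  This intrinsic form is what makes transport-invariance under EVERY admissible `(Γ, Γ_Θ)` a three-line argument in B2.

HONEST LABEL (abc-iut-L2-lead R1352, verbatim): «a DESIGNED tempered toy with print's monodromy combinatorics — loop ↦
`Δ̄^ell` (`b`-cycle), the inversion INVERTS it, unipotent monodromy `x ↦ x·z` on the `a`-cycle, `z` = cusp inertia = `Δ̄_Θ`
central; `G_K := 1`; NOT a Tate curve, NOT the tempered fundamental group of a curve; consistency ≠ faithfulness; nothing
here takes a side on anything printed.»
HONEST FRAMING: bookkeeping about OUR typed interface at a DESIGNED toy; nothing about [EtTh] in print; no bearing on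
[IUTchIII] Cor. 3.12; no side taken; typed ≠ proved.  PROOF-ONLY (0 `def`, 0 `instance`, 0 notation).
-/

noncomputable section

namespace Literature.AnabelianGeometry.EtaleTheta.ThetaCovers.MonodromyModel

open Multiplicative HeisenbergWitness TemperedModel DihedralGroup ThetaOrbitData

variable (l : ℕ)

/-! ## 1. Coordinates on `Π^tp_Ÿ = (ℤ/l)²` and on the cyclotome `Δ_Θ = ⟨z⟩/1` -/

/-- On `Π^tp_Ÿ` (`d = 1`) the coordinate `b` is additive. (toy bookkeeping) [cite: MochizukiEtTh2009, Def 2.5 p.39] -/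
theorem bC_mul_of_mem {g : TG l} (hg : g ∈ PiYddT l) (h : TG l) : bC l (g * h) = bC l g + bC l h := by
  rw [bC_mul, ((mem_PiYddT_iff l g).mp hg).1, map_one, eps_one, one_mul]

/-- On `Π^tp_Ÿ` (`d = 1`) the coordinate `c` is additive. (toy bookkeeping) [cite: MochizukiEtTh2009, Def 2.5 p.39] -/
theorem cC_mul_of_mem {g : TG l} (hg : g ∈ PiYddT l) (h : TG l) : cC l (g * h) = cC l g + cC l h := by
  rw [cC_mul, ((mem_PiYddT_iff l g).mp hg).1, map_one, rotIdx_one, zero_mul, add_zero]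

/-- Coordinates of `1`. (toy bookkeeping) [cite: MochizukiEtTh2009, Def 2.5 p.39] -/
theorem bC_one : bC l 1 = 0 := rfl

/-- Coordinates of `1`. (toy bookkeeping) [cite: MochizukiEtTh2009, Def 2.5 p.39] -/
theorem cC_one : cC l 1 = 0 := rfl

/-- On `Π^tp_Ÿ` the coordinate `c` of an inverse is `−c`. (toy bookkeeping) [cite: MochizukiEtTh2009, Def 2.5 p.39] -/
theorem cC_inv_of_mem {g : TG l} (hg : g ∈ PiYddT l) : cC l g⁻¹ = -cC l g := by
  have h := cC_mul_of_mem l hg g⁻¹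
  rw [mul_inv_cancel, cC_one] at h
  exact (neg_eq_of_add_eq_zero_right h.symm).symm

/-- On `Π^tp_Ÿ` the coordinate `b` of an inverse is `−b`. (toy bookkeeping) [cite: MochizukiEtTh2009, Def 2.5 p.39] -/
theorem bC_inv_of_mem {g : TG l} (hg : g ∈ PiYddT l) : bC l g⁻¹ = -bC l g := by
  have h := bC_mul_of_mem l hg g⁻¹
  rw [mul_inv_cancel, bC_one] at h
  exact (neg_eq_of_add_eq_zero_right h.symm).symm

/-- An element of `top = ⟨z⟩` is `z^c`, `c` its `c`-coordinate. (toy bookkeeping) [cite: MochizukiEtTh2009, Def 2.7 p.41] -/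
theorem eq_thetaGen_of_mem (τ : ↥(thetaTop l)) : τ = thetaGen l (ofAdd (cC l (τ : TG l))) := by
  obtain ⟨hb, hd, he⟩ := (mem_thetaTop_iff l _).mp τ.2
  apply Subtype.ext
  rw [coe_thetaGen]
  have h := eq_embCu_of_coords l hb he
  rw [hd] at h
  exact h

/-- Every element of `top` is central in `Π^tp_C` (`D_∞` fixes `(0, c)`; `(ℤ/l)²` is abelian). (toy bookkeeping)
[cite: MochizukiEtTh2009, Def 2.7 p.41] -/
theorem conj_eq_of_mem_thetaTop (x : TG l) {τ : TG l} (hτ : τ ∈ thetaTop l) : x * τ * x⁻¹ = τ := by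
  obtain ⟨hb, hd, he⟩ := (mem_thetaTop_iff l _).mp hτ
  refine TG.ext l ?_ ?_ ?_ ?_
  · rw [right_mul, right_mul, right_inv, hd, mul_one, mul_inv_cancel]
  · simp only [bC_mul, bC_inv, right_mul, hb, hd, mul_one, mul_zero, add_zero]
    rcases x.1.right with i | i <;> simp
  · simp only [cC_mul, cC_inv, bC_inv, right_mul, hb, hd, mul_one, mul_zero, add_zero]
    rcases x.1.right with i | i <;> simp
  · rw [snd_mul, snd_mul, snd_inv, he, mul_one, mul_inv_cancel]

/-- `c ↦ [z^c]` is multiplicative. (toy bookkeeping) [cite: MochizukiEtTh2009, Def 2.7 p.41] -/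
theorem thetaCoeff_mul (a b : Multiplicative (ZMod l)) : thetaCoeff l (a * b) = thetaCoeff l a * thetaCoeff l b := by
  show (QuotientGroup.mk (thetaGen l (a * b)) : DTh l) = _
  rw [map_mul, QuotientGroup.mk_mul]
  rfl

/-- `c ↦ [z^c]` sends `1` to `1`. (toy bookkeeping) [cite: MochizukiEtTh2009, Def 2.7 p.41] -/
theorem thetaCoeff_one : thetaCoeff l 1 = 1 := by
  show (QuotientGroup.mk (thetaGen l 1) : DTh l) = 1
  rw [map_one, QuotientGroup.mk_one]

/-- `c ↦ [z^c]` commutes with integer powers. (toy bookkeeping) [cite: MochizukiEtTh2009, Def 2.7 p.41] -/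
theorem thetaCoeff_zpow (a : Multiplicative (ZMod l)) (n : ℤ) : thetaCoeff l (a ^ n) = thetaCoeff l a ^ n := by
  show (QuotientGroup.mk (thetaGen l (a ^ n)) : DTh l) = _
  rw [map_zpow, QuotientGroup.mk_zpow]
  rfl

/-- `c ↦ z^c` is injective. (toy bookkeeping) [cite: MochizukiEtTh2009, Def 2.7 p.41] -/
theorem thetaGen_injective : Function.Injective (thetaGen l) := fun u v huv => by
  have h := congrArg (fun τ : ↥(thetaTop l) => (τ : TG l)) huv
  simp only [coe_thetaGen] at h
  exact (Prod.ext_iff.mp (embCu_injective l h)).1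

/-- `c ↦ [z^c]` is injective (`bot = 1`). (toy bookkeeping) [cite: MochizukiEtTh2009, Def 2.7 p.41] -/
theorem thetaCoeff_injective : Function.Injective (thetaCoeff l) := by
  intro a b h
  have h' : ((thetaGen l a)⁻¹ * thetaGen l b : ↥(thetaTop l)) ∈ (⊥ : Subgroup (TG l)).subgroupOf (thetaTop l) :=
    QuotientGroup.eq.mp h
  rw [Subgroup.mem_subgroupOf, Subgroup.mem_bot, Subgroup.coe_mul, Subgroup.coe_inv, inv_mul_eq_one] at h'
  exact thetaGen_injective l (Subtype.ext h')

/-- Every element of `Δ_Θ` is `[z^c]`: `[τ] = [z^{c(τ)}]`. (toy bookkeeping) [cite: MochizukiEtTh2009, Def 2.7 p.41] -/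
theorem mk_eq_thetaCoeff (τ : ↥(thetaTop l)) :
    (QuotientGroup.mk τ : DTh l) = thetaCoeff l (ofAdd (cC l (τ : TG l))) :=
  congrArg (fun σ : ↥(thetaTop l) => (QuotientGroup.mk σ : DTh l)) (eq_thetaGen_of_mem l τ)

/-- `c ↦ [z^c]` is surjective. (toy bookkeeping) [cite: MochizukiEtTh2009, Def 2.7 p.41] -/
theorem thetaCoeff_surjective : Function.Surjective (thetaCoeff l) := by
  intro a
  induction a using QuotientGroup.induction_on with
  | H τ => exact ⟨ofAdd (cC l (τ : TG l)), (mk_eq_thetaCoeff l τ).symm⟩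

/-- `Δ_Θ` of the toy is commutative. (toy bookkeeping) [cite: MochizukiEtTh2009, Def 2.7 p.41] -/
theorem deltaTheta_comm (a b : DTh l) : a * b = b * a := by
  obtain ⟨u, rfl⟩ := thetaCoeff_surjective l a
  obtain ⟨v, rfl⟩ := thetaCoeff_surjective l b
  rw [← thetaCoeff_mul, ← thetaCoeff_mul, mul_comm]

/-! ## 2. The toy theta class: multiplicativity, restriction to the cusp inertia, `Gal(Y/X)`-translates -/

/-- `η_{ε,k}` is multiplicative on `Π^tp_Ÿ`. (toy bookkeeping) [cite: MochizukiEtTh2009, Def 2.7 p.41] -/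
theorem etaFn_mul (ε k : ZMod l) (g h : ↥(PiYddT l)) : etaFn l ε k (g * h) = etaFn l ε k g * etaFn l ε k h := by
  rw [etaFn_apply, etaFn_apply, etaFn_apply, ← thetaCoeff_mul, ← ofAdd_add, Subgroup.coe_mul,
    bC_mul_of_mem l g.2, cC_mul_of_mem l g.2]
  congr 2
  ring

/-- `η_{ε,k}(1) = 1`. (toy bookkeeping) [cite: MochizukiEtTh2009, Def 2.7 p.41] -/
theorem etaFn_one (ε k : ZMod l) : etaFn l ε k 1 = 1 := by
  rw [etaFn_apply, Subgroup.coe_one, bC_one, cC_one, mul_zero, mul_zero, add_zero, ofAdd_zero, thetaCoeff_one]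

/-- **`η_{ε,k}` on the cusp inertia: `[τ] ↦ [τ]^{±1}`** — the toy theta class is TAUTOLOGICAL on `Δ_Θ = ⟨z⟩`.
(toy bookkeeping for [EtTh] Prop. 1.3 / Def. 2.7; no claim about print) [cite: MochizukiEtTh2009, Def 2.7 p.41] -/
theorem etaFn_apply_thetaTop (ε k : ZMod l) (σ : ℤ) (hσ : (σ : ZMod l) = ε) (τ : ↥(thetaTop l)) :
    etaFn l ε k ⟨τ, thetaTop_le_PiYddT l τ.2⟩ = (QuotientGroup.mk τ : DTh l) ^ σ := by
  rw [etaFn_apply, mk_eq_thetaCoeff, ← thetaCoeff_zpow, ← ofAdd_zsmul, zsmul_eq_mul, hσ]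
  congr 2
  show ε * cC l (τ : TG l) + k * bC l (τ : TG l) = ε * cC l (τ : TG l)
  rw [((mem_thetaTop_iff l _).mp τ.2).1, mul_zero, add_zero]

/-- `η_{−ε,−k} = η_{ε,k}⁻¹` pointwise (so `η_{−1,−k}` is the inverse of the translate `η_{1,k}`). (toy bookkeeping)
[cite: MochizukiEtTh2009, Def 2.7 p.41] -/
theorem etaFn_neg (ε k : ZMod l) (g : ↥(PiYddT l)) : etaFn l (-ε) (-k) g = (etaFn l ε k g)⁻¹ := by
  rw [etaFn_apply, etaFn_apply, ← zpow_neg_one, ← thetaCoeff_zpow, ← ofAdd_zsmul, neg_one_zsmul]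
  congr 2
  ring

/-- `t ∈ Π^tp_{C̲} = {b = 0}`, `t ∈ Π^tp_{X̲} = {b = 0, d rotation}`, `t ∈ Π^tp_X` — the loop lies in every member of the
`C̲`-list of the toy (its `X̲ → X` kills the `a`-cycle). (toy bookkeeping) [cite: MochizukiEtTh2009, Def 2.5 p.39] -/
theorem tT_mem : tT l ∈ (heisB0 l).comap (PhiT l) ∧ tT l ∈ (heisB0 l ⊓ heisPiX l).comap (PhiT l) ∧
    tT l ∈ (heisPiX l).comap (PhiT l) := by
  have hX : tT l ∈ (heisPiX l).comap (PhiT l) := (mem_comap_PhiT_heisPiX l).mpr ⟨1, rfl⟩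
  have hB : tT l ∈ (heisB0 l).comap (PhiT l) := (mem_comap_PhiT_heisB0 l).mpr rfl
  exact ⟨hB, Subgroup.mem_inf.mpr ⟨hB, hX⟩, hX⟩

/-- **Conjugation by the loop is the shear** on `Π^tp_Ÿ`: `t (b, c) t⁻¹ = (b, c + b)`. (toy bookkeeping for [EtTh] §1
«`Π^tp_X ↠ Z`» acting on `Δ_Ÿ`; no claim about print) [cite: MochizukiEtTh2009, Def 2.5 p.39] -/
theorem conj_tT_coords {g : TG l} (hg : g ∈ PiYddT l) :
    (tT l * g * (tT l)⁻¹).1.right = 1 ∧ bC l (tT l * g * (tT l)⁻¹) = bC l g ∧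
      cC l (tT l * g * (tT l)⁻¹) = cC l g + bC l g ∧ (tT l * g * (tT l)⁻¹).2 = 1 := by
  obtain ⟨hd, he⟩ := (mem_PiYddT_iff l g).mp hg
  have ht : (tT l).1.right = r 1 := rfl
  have htb : bC l (tT l) = 0 := rfl
  have htc : cC l (tT l) = 0 := rfl
  have hte : (tT l).2 = 1 := rfl
  refine ⟨?_, ?_, ?_, ?_⟩
  · rw [right_mul, right_mul, right_inv, hd, mul_one, mul_inv_cancel]
  · simp only [bC_mul, bC_inv, right_mul, ht, hd, htb, mul_one, dihedralRed_r, map_one, eps_r]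
    ring
  · simp only [cC_mul, cC_inv, bC_inv, right_mul, ht, hd, htb, htc, mul_one, dihedralRed_r, map_one, eps_r,
      rotIdx_r]
    ring
  · rw [snd_mul, snd_mul, snd_inv, he, hte, mul_one, mul_inv_cancel]

/-- `γ_t` maps `Π^tp_Ÿ` into itself. (toy bookkeeping) [cite: MochizukiEtTh2009, Def 2.5 p.39] -/
theorem conj_tT_mem {g : TG l} (hg : g ∈ PiYddT l) : tT l * g * (tT l)⁻¹ ∈ PiYddT l :=
  (mem_PiYddT_iff l _).mpr ⟨(conj_tT_coords l hg).1, (conj_tT_coords l hg).2.2.2⟩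

/-- **The `Gal(Y/X)`-translate of the toy theta class by one step**: `η_{1,k} ∘ γ_t = η_{1,k+1}` on `Π^tp_Ÿ`.
(toy bookkeeping for [EtTh] Def. 2.7 «`η̈^{Θ,ℤ}`»; no claim about print) [cite: MochizukiEtTh2009, Def 2.7 p.41] -/
theorem etaFn_one_conj_tT (k : ZMod l) (g : ↥(PiYddT l)) :
    etaFn l 1 k ⟨tT l * g * (tT l)⁻¹, conj_tT_mem l g.2⟩ = etaFn l 1 (k + 1) g := by
  rw [etaFn_apply, etaFn_apply]
  congr 2
  show 1 * cC l (tT l * g * (tT l)⁻¹) + k * bC l (tT l * g * (tT l)⁻¹) = 1 * cC l g + (k + 1) * bC l g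
  rw [(conj_tT_coords l g.2).2.1, (conj_tT_coords l g.2).2.2.1]
  ring

/-- **`η̈^{Θ,ℤ×μ₂}` IS the `(Gal(Y/X) × μ₂)`-orbit of `η₀`**: `η₀ ∘ γ_{t^k} = η_{1,k}` for every `k : ℕ` (and
`η_{−1,−k} = η_{1,k}⁻¹`, `etaFn_neg`). (toy bookkeeping for [EtTh] Def. 2.7; no claim about print) [cite: MochizukiEtTh2009, Def 2.7 p.41] -/
theorem etaFn_one_zero_conj_tT_pow (k : ℕ) (g : ↥(PiYddT l)) (hk : tT l ^ k * g * (tT l ^ k)⁻¹ ∈ PiYddT l) :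
    etaFn l 1 0 ⟨tT l ^ k * g * (tT l ^ k)⁻¹, hk⟩ = etaFn l 1 (k : ZMod l) g := by
  induction k generalizing g with
  | zero =>
    simp only [Nat.cast_zero]
    congr 1
    apply Subtype.ext
    show tT l ^ 0 * (g : TG l) * (tT l ^ 0)⁻¹ = g
    rw [pow_zero, one_mul, inv_one, mul_one]
  | succ k ih =>
    have hk' : tT l ^ k * (tT l * g * (tT l)⁻¹) * (tT l ^ k)⁻¹ ∈ PiYddT l :=
      (PiYddT_normal l).conj_mem _ (conj_tT_mem l g.2) _
    have heq : (⟨tT l ^ (k + 1) * g * (tT l ^ (k + 1))⁻¹, hk⟩ : ↥(PiYddT l)) =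
        ⟨tT l ^ k * (tT l * g * (tT l)⁻¹) * (tT l ^ k)⁻¹, hk'⟩ := by
      apply Subtype.ext
      show tT l ^ (k + 1) * (g : TG l) * (tT l ^ (k + 1))⁻¹ = tT l ^ k * (tT l * g * (tT l)⁻¹) * (tT l ^ k)⁻¹
      rw [pow_succ]
      group
    rw [heq, ih ⟨tT l * g * (tT l)⁻¹, conj_tT_mem l g.2⟩ hk', etaFn_one_conj_tT, Nat.cast_succ]

/-- `(x₀^n)` has coordinates `(n, 0, 1, 1)`. (toy bookkeeping) [cite: MochizukiEtTh2009, Def 2.5 p.39] -/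
theorem xT_pow_coords (n : ℕ) :
    (xT l ^ n).1.right = 1 ∧ bC l (xT l ^ n) = n ∧ cC l (xT l ^ n) = 0 ∧ (xT l ^ n).2 = 1 := by
  induction n with
  | zero => exact ⟨rfl, by rw [pow_zero, bC_one, Nat.cast_zero], by rw [pow_zero, cC_one], rfl⟩
  | succ n ih =>
    have hmem : xT l ^ n ∈ PiYddT l := (mem_PiYddT_iff l _).mpr ⟨ih.1, ih.2.2.2⟩
    refine ⟨?_, ?_, ?_, ?_⟩
    · rw [pow_succ, right_mul, ih.1, one_mul]; rfl
    · rw [pow_succ, bC_mul_of_mem l hmem, ih.2.1, Nat.cast_succ]; rfl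
    · rw [pow_succ, cC_mul_of_mem l hmem, ih.2.2.1, zero_add]; rfl
    · rw [pow_succ, snd_mul, ih.2.2.2, one_mul]; rfl

/-- `x₀ ∈ Π^tp_Ÿ`. (toy bookkeeping) [cite: MochizukiEtTh2009, Def 2.5 p.39] -/
theorem xT_mem : xT l ∈ PiYddT l := (mem_PiYddT_iff l _).mpr ⟨rfl, rfl⟩

/-- **INTRINSIC CHARACTERISATION of `η̈^{Θ,ℤ×μ₂}`**: a class lies in the orbit collection of part A iff it is the
singleton of a MULTIPLICATIVE `η : Π^tp_Ÿ → Δ_Θ` whose restriction to the cusp inertia `Δ_Θ = ⟨z⟩` is `[·]^{σ}`,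
`σ = ±1`. (toy bookkeeping for [EtTh] Def. 2.7; no claim about print) [cite: MochizukiEtTh2009, Def 2.7 p.41] -/
theorem mem_etaColl_iff [NeZero l] (c : Set (↥(PiYddT l) → DTh l)) :
    c ∈ etaColl l ↔ ∃ η, c = {η} ∧ (∀ g h, η (g * h) = η g * η h) ∧
      ∃ σ : ℤ, (σ = 1 ∨ σ = -1) ∧ ∀ τ : ↥(thetaTop l),
        η ⟨τ, thetaTop_le_PiYddT l τ.2⟩ = (QuotientGroup.mk τ : DTh l) ^ σ := by
  constructor
  · rintro ⟨ε, k, hε, rfl⟩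
    refine ⟨etaFn l ε k, rfl, etaFn_mul l ε k, ?_⟩
    rcases hε with rfl | rfl
    · exact ⟨1, Or.inl rfl, fun τ => etaFn_apply_thetaTop l 1 k 1 (by rw [Int.cast_one]) τ⟩
    · exact ⟨-1, Or.inr rfl, fun τ => etaFn_apply_thetaTop l (-1) k (-1) (by rw [Int.cast_neg, Int.cast_one]) τ⟩
  · rintro ⟨η, rfl, hmul, σ, hσ, hτ⟩
    -- the `x₀`-value of `η` determines `k`
    obtain ⟨kM, hk⟩ := thetaCoeff_surjective l (η ⟨xT l, xT_mem l⟩)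
    refine ⟨(σ : ZMod l), toAdd kM, ?_, ?_⟩
    · rcases hσ with rfl | rfl
      · exact Or.inl (by rw [Int.cast_one])
      · exact Or.inr (by rw [Int.cast_neg, Int.cast_one])
    · congr 1
      funext g
      -- decompose `g = x₀^n · τ`, `n = b(g)`, `τ ∈ top`
      have h1 : η 1 = 1 := by
        have h := hmul 1 1
        rw [one_mul] at h
        exact (mul_left_cancel (a := η 1) (by rw [mul_one]; exact h)).symm
      have hηpow : ∀ m : ℕ, η (⟨xT l, xT_mem l⟩ ^ m) = η ⟨xT l, xT_mem l⟩ ^ m := by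
        intro m
        induction m with
        | zero => rw [pow_zero, pow_zero, h1]
        | succ m ih => rw [pow_succ, hmul, ih, pow_succ]
      obtain ⟨n, hn⟩ : ∃ n : ℕ, (n : ZMod l) = bC l (g : TG l) := ⟨(bC l (g : TG l)).val, ZMod.natCast_zmod_val _⟩
      have hxn : xT l ^ n ∈ PiYddT l := (mem_PiYddT_iff l _).mpr ⟨(xT_pow_coords l n).1, (xT_pow_coords l n).2.2.2⟩
      have hτmem : (xT l ^ n)⁻¹ * (g : TG l) ∈ thetaTop l := by
        refine (mem_thetaTop_iff l _).mpr ⟨?_, ?_, ?_⟩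
        · rw [bC_mul_of_mem l ((PiYddT l).inv_mem hxn), bC_inv_of_mem l hxn, (xT_pow_coords l n).2.1, hn,
            neg_add_cancel]
        · rw [right_mul, right_inv, (xT_pow_coords l n).1, inv_one, one_mul]
          exact ((mem_PiYddT_iff l _).mp g.2).1
        · rw [snd_mul, snd_inv, (xT_pow_coords l n).2.2.2, inv_one, one_mul]
          exact ((mem_PiYddT_iff l _).mp g.2).2
      have hcτ : cC l ((xT l ^ n)⁻¹ * (g : TG l)) = cC l (g : TG l) := by
        rw [cC_mul_of_mem l ((PiYddT l).inv_mem hxn), cC_inv_of_mem l hxn, (xT_pow_coords l n).2.2.1, neg_zero,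
          zero_add]
      have hdec : g = ⟨xT l, xT_mem l⟩ ^ n * ⟨(xT l ^ n)⁻¹ * (g : TG l), thetaTop_le_PiYddT l hτmem⟩ := by
        apply Subtype.ext
        show (g : TG l) = xT l ^ n * ((xT l ^ n)⁻¹ * g)
        rw [mul_inv_cancel_left]
      have hsplit : η g = η (⟨xT l, xT_mem l⟩ ^ n) * η ⟨(xT l ^ n)⁻¹ * (g : TG l), thetaTop_le_PiYddT l hτmem⟩ := by
        rw [← hmul, ← hdec]
      rw [hsplit, hηpow, hτ ⟨_, hτmem⟩, ← hk, mk_eq_thetaCoeff, hcτ, ← zpow_natCast, ← thetaCoeff_zpow,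
        ← thetaCoeff_zpow, ← thetaCoeff_mul, etaFn_apply]
      congr 1
      apply toAdd.injective
      rw [toAdd_mul, toAdd_zpow, toAdd_zpow, toAdd_ofAdd, toAdd_ofAdd, zsmul_eq_mul, zsmul_eq_mul, Int.cast_natCast,
        hn]
      ring

end Literature.AnabelianGeometry.EtaleTheta.ThetaCovers.MonodromyModel

end
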